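import Literature.AlgebraicGeometry.Motives.ChowConeLocal
import Literature.Geometry.Kaehler.AnalyticSetComponentsProofs
import HarnessLib

/-!
# Chow's theorem, Remmert–Stein at the vertex of a cone, II: the unramified part and its closure

Family `hodge` (**hodge.S17**, Chow's theorem), layer `Literature/AlgebraicGeometry/Motives`.
Continuation of `ChowConeLocal.lean` (setting: `Z ⊆ ℂᵈ × ℂᵐ⁺¹` closed, stable under all
scalars, cut out by holomorphic equations near every point `≠ 0`, with isolating fibre space
`Z ∩ ({0} × ℂᵐ⁺¹) ⊆ {0}`; `π (z', w) = z'`).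

Let `G ⊆ ℂᵈ ∖ {0}` be the set of base points over a neighbourhood of which `Z` is the union of the
graphs of finitely many holomorphic maps with pairwise distinct values (the *unramified* part of
the projection; `G` enters as a parameter characterised by the hypothesis `hG`). We prove
[Chirka1989, §4.1–4.3; Mumford1981, §4A (4.7), (4.10)]:

* `G` is open, stable under non-zero scalars, and dense in `ℂᵈ` (`isOpen_of_good`,
  `smul_mem_of_good`, `mem_closure_of_good`); the fibres of `Z` off the vertex have uniformly
  boundedly many points (`exists_forall_fibre_card_le`, compactness of the unit sphere); off the
  vertex the complement of `G` is thin (`exists_thin_of_good`, the discriminant of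
  `exists_local_cover`).
* `coverPiece_of_good` — over the punctured ball `ball 0 ρ ∖ {0}`, the part of `Z` over `G` is a
  `Literature.Analysis.Complex.SCV.CoverPiece`.
* `CoverPiece.closure_inter_eq_of_eqOn_defFn` — a variant of
  `Literature.Analysis.Complex.SCV.CoverPiece.closure_inter_eq` (Chirka §4.3 Thm.) in which the
  holomorphic extensions of the canonical defining functions are *given* on an arbitrary open
  set of the total space whose base lies in the closure of `G` (same proof).
* `isZeroSetAt_closure_good` — **the closure `Z₁` of the part of `Z` over `G` is cut out by
  holomorphic equations near every point of `ℂᵈ × ℂᵐ⁺¹, the vertex included**: the extended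
  canonical defining functions on `(ball 0 ρ ∖ {0}) × ℂᵐ⁺¹` are bounded near `{0} × ℂᵐ⁺¹`, hence
  extend across it by the Riemann extension theorem
  (`Literature.Analysis.Complex.SCV.exists_differentiableOn_eqOn_of_thin`; the hyperplane
  `{z'_{i₀} = 0}` is thin), and still cut out the closure; conic invariance moves any point into
  the ball. Also `Z₁` is a closed cone contained in `Z` (`closure_good_subset`,
  `smul_mem_closure_good`).

## References

* [Chirka1989] E. M. Chirka, *Complex Analytic Sets*, Kluwer (1989), §4.1–4.3 (analytic covers,
  canonical defining functions, Thm. 4.3), §4.4, §7.1.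
* [Mumford1981] D. Mumford, *Algebraic Geometry I: Complex Projective Varieties*, §4A (4.7)–(4.10).
-/

noncomputable section

open scoped Topology
open Set Filter Metric Function
open Literature.Analysis.Complex.SCV (IsZeroSetAt CoverPiece momentFn prod_sum_pow_mul_eq_zero_iff
  exists_differentiableOn_eqOn_of_thin)

namespace Literature.AlgebraicGeometry.Motives

/-! ### A variant of Chirka's Theorem 4.3 with prescribed extensions -/

section CoverPieceVariant

variable {E' : Type*} [NormedAddCommGroup E'] [NormedSpace ℂ E'] {n : ℕ}
  {S : Set (E' × (Fin n → ℂ))} {V' G : Set E'} {K : ℕ} {R : ℝ}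

/-- **Closures of cover pieces are cut out by the extended canonical defining functions**
(variant of `CoverPiece.closure_inter_eq`, [Chirka1989, §4.3 Thm., p. 47]). Let `S` be a cover
piece over `G ⊆ V'` and let `U` be an open subset of the total space all of whose base points lie
in the closure of `G`. If functions `Φ_t`, continuous on `U`, agree with the canonical defining
functions `Φ_t = ∏_{b ∈ fibre} ζ_t (w - b)` over `G`, then on `U` the closure of `S` is the common
zero set of `Φ_0, …, Φ_{K(n-1)}`. (Same proof as the library theorem: approximate, extract a
convergent subsequence of the bounded fibres, pass to the limit, and use the norm trick
`prod_sum_pow_mul_eq_zero_iff`.) Declared in the namespace of the structure it extends.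
[cite: Chirka1989, §4.3 Thm., p. 47] -/
theorem _root_.Literature.Analysis.Complex.SCV.CoverPiece.closure_inter_eq_of_eqOn_defFn
    (h : CoverPiece S V' G K R) {U : Set (E' × (Fin n → ℂ))} (hUo : IsOpen U)
    (hUG : ∀ x ∈ U, x.1 ∈ closure G) (Φ : ℂ → E' × (Fin n → ℂ) → ℂ)
    (hΦc : ∀ t, ContinuousOn (Φ t) U) (hΦeq : ∀ t, EqOn (Φ t) (h.defFn t) (G ×ˢ univ)) :
    closure S ∩ U = U ∩ {x | ∀ i : Fin (K * (n - 1) + 1), Φ ((i : ℕ) : ℂ) x = 0} := by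
  classical
  set M := K * (n - 1) + 1 with hM
  have hΦS : ∀ t, ∀ y ∈ S, Φ t y = 0 := fun t y hy => by
    rw [hΦeq t ⟨h.fst_mem y hy, mem_univ _⟩]; exact h.defFn_eq_zero t hy
  have hΦca : ∀ t, ∀ x ∈ U, ContinuousAt (Φ t) x := fun t x hx =>
    (hΦc t).continuousAt (hUo.mem_nhds hx)
  ext x
  constructor
  · rintro ⟨hxcl, hxU⟩
    refine ⟨hxU, fun i => ?_⟩
    have h1 := (hΦca ((i : ℕ) : ℂ) x hxU).continuousWithinAt.mem_closure_image (s := S) hxcl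
    have h2 : Φ ((i : ℕ) : ℂ) '' S ⊆ {0} := by
      rintro _ ⟨y, hy, rfl⟩; exact hΦS _ y hy
    have h3 := (closure_mono h2) h1
    rw [closure_singleton] at h3
    exact h3
  · rintro ⟨hxU, hx0⟩
    refine ⟨?_, hxU⟩
    -- base points with fibres of constant cardinality approximating `x.1`
    set Gk : Fin (K + 1) → Set E' := fun k => {z' ∈ G | (h.fibre z').card = k} with hGk
    have hGU : G = ⋃ k, Gk k := by
      ext z'
      simp only [mem_iUnion, hGk, mem_setOf_eq]
      constructor
      · intro hz'
        exact ⟨⟨(h.fibre z').card, Nat.lt_succ_of_le (h.card_fibre_le z')⟩, hz', rfl⟩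
      · rintro ⟨k, hz', -⟩; exact hz'
    obtain ⟨k, hk⟩ : ∃ k : Fin (K + 1), x.1 ∈ closure (Gk k) := by
      have := hUG x hxU
      rw [hGU, closure_iUnion_of_finite] at this
      exact mem_iUnion.1 this
    obtain ⟨u, huG, hu⟩ := mem_closure_iff_seq_limit.1 hk
    -- enumerations of the fibres
    have hcard : ∀ ν, (h.fibre (u ν)).card = k := fun ν => (huG ν).2
    set b : ℕ → Fin k → (Fin n → ℂ) := fun ν j =>
      (((h.fibre (u ν)).equivFinOfCardEq (hcard ν)).symm j : Fin n → ℂ) with hb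
    have hbmem : ∀ ν j, b ν j ∈ h.fibre (u ν) := fun ν j =>
      (((h.fibre (u ν)).equivFinOfCardEq (hcard ν)).symm j).2
    have hbS : ∀ ν j, (u ν, b ν j) ∈ S := fun ν j => (h.mem_fibre (huG ν).1).1 (hbmem ν j)
    -- a convergent subsequence of the fibres
    have hbdd : ∀ ν, b ν ∈ closedBall (0 : Fin k → Fin n → ℂ) (max R 0) := fun ν => by
      rw [mem_closedBall, dist_zero_right, pi_norm_le_iff_of_nonneg (le_max_right _ _)]
      exact fun j => (h.norm_le_of_mem_fibre (hbmem ν j)).trans (le_max_left _ _)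
    obtain ⟨β, -, φ, hφ, hbφ⟩ := (isCompact_closedBall _ _).tendsto_subseq hbdd
    -- pass to the limit in the defining functions
    have hlim : ∀ i : Fin M, ∏ j, momentFn n ((i : ℕ) : ℂ) (x.2 - β j) = 0 := by
      intro i
      set t : ℂ := ((i : ℕ) : ℂ) with ht
      have hval : ∀ ν, Φ t (u (φ ν), x.2) = ∏ j, momentFn n t (x.2 - b (φ ν) j) := by
        intro ν
        rw [hΦeq t ⟨(huG (φ ν)).1, mem_univ _⟩]
        unfold CoverPiece.defFn
        rw [← Finset.prod_coe_sort,
          ← ((h.fibre (u (φ ν))).equivFinOfCardEq (hcard (φ ν))).symm.prod_comp]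
      have hL : Tendsto (fun ν => Φ t (u (φ ν), x.2)) atTop (𝓝 (Φ t x)) := by
        have hy : Tendsto (fun ν => ((u (φ ν), x.2) : E' × (Fin n → ℂ))) atTop (𝓝 x) := by
          have := (hu.comp hφ.tendsto_atTop).prodMk_nhds (tendsto_const_nhds (x := x.2))
          simpa using this
        exact (hΦca t x hxU).tendsto.comp hy
      have hR : Tendsto (fun ν => ∏ j, momentFn n t (x.2 - b (φ ν) j)) atTop
          (𝓝 (∏ j, momentFn n t (x.2 - β j))) := by
        have hc : Continuous fun c : Fin k → Fin n → ℂ => ∏ j, momentFn n t (x.2 - c j) :=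
          continuous_finsetProd _ fun j _ => (CoverPiece.continuous_momentFn t).comp
            (continuous_const.sub (continuous_apply j))
        exact hc.continuousAt.tendsto.comp hbφ
      have := tendsto_nhds_unique (hL.congr hval) hR
      rw [← this]
      exact hx0 i
    -- the norm trick: `x.2` is one of the limit fibre points
    have hkK : (Finset.univ : Finset (Fin k)).card ≤ K := by
      rw [Finset.card_univ, Fintype.card_fin]; exact Nat.le_of_lt_succ k.2
    obtain ⟨j, -, hj⟩ := (prod_sum_pow_mul_eq_zero_iff (K := K)
      (D := (Finset.univ : Finset (Fin k))) hkK (fun j => x.2 - β j)).1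
      (fun i => by simpa [momentFn] using hlim i)
    have hxβ : x.2 = β j := sub_eq_zero.1 hj
    -- points of `S` converging to `x`
    refine mem_closure_of_tendsto (f := fun ν => ((u (φ ν), b (φ ν) j) : E' × (Fin n → ℂ)))
      (b := atTop) ?_ (Filter.Eventually.of_forall fun ν => hbS (φ ν) j)
    have h1 : Tendsto (fun ν => b (φ ν) j) atTop (𝓝 (β j)) :=
      ((continuous_apply j).continuousAt.tendsto.comp hbφ)
    have := (hu.comp hφ.tendsto_atTop).prodMk_nhds h1
    rw [show x = (x.1, β j) from Prod.ext rfl hxβ]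
    simpa using this

end CoverPieceVariant

/-! ### The unramified part `G` of the projection -/

section Good

variable {d m : ℕ}

/-- **Locality of the sheet description**: if over `ball z' δ` the set `Z` is the union of the
graphs of the `τ j`, the same holds over any smaller ball `ball y (δ - dist y z')`, `y ∈ ball z' δ`,
with the same sheets. [folklore] -/
theorem sheets_mono {Z : Set ((Fin d → ℂ) × (Fin (m + 1) → ℂ))} {z' y : Fin d → ℂ} {δ : ℝ}
    (hy : y ∈ ball z' δ) {k : ℕ} {τ : Fin k → (Fin d → ℂ) → (Fin (m + 1) → ℂ)}
    (hτd : ∀ j, DifferentiableOn ℂ (τ j) (ball z' δ))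
    (hτne : ∀ y' ∈ ball z' δ, ∀ j j', j ≠ j' → τ j y' ≠ τ j' y')
    (hτZ : ∀ y' ∈ ball z' δ, ∀ w, (y', w) ∈ Z ↔ ∃ j, w = τ j y') :
    0 < δ - dist y z' ∧ (∀ j, DifferentiableOn ℂ (τ j) (ball y (δ - dist y z'))) ∧
      (∀ y' ∈ ball y (δ - dist y z'), ∀ j j', j ≠ j' → τ j y' ≠ τ j' y') ∧
      ∀ y' ∈ ball y (δ - dist y z'), ∀ w, (y', w) ∈ Z ↔ ∃ j, w = τ j y' := by
  have hsub : ball y (δ - dist y z') ⊆ ball z' δ := ball_subset_ball' (by linarith)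
  rw [mem_ball] at hy
  exact ⟨by linarith, fun j => (hτd j).mono hsub, fun y' hy' => hτne y' (hsub hy'),
    fun y' hy' => hτZ y' (hsub hy')⟩

variable {Z : Set ((Fin d → ℂ) × (Fin (m + 1) → ℂ))} {G : Set (Fin d → ℂ)}

/-- **`G` is open.** [Chirka, *Complex Analytic Sets*, §4.1] [folklore] -/
theorem isOpen_of_good
    (hG : ∀ z', z' ∈ G ↔ z' ≠ 0 ∧ ∃ δ > 0, ∃ (k : ℕ) (τ : Fin k → (Fin d → ℂ) → (Fin (m + 1) → ℂ)),
      (∀ j, DifferentiableOn ℂ (τ j) (ball z' δ)) ∧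
      (∀ y ∈ ball z' δ, ∀ j j', j ≠ j' → τ j y ≠ τ j' y) ∧
      ∀ y ∈ ball z' δ, ∀ w, (y, w) ∈ Z ↔ ∃ j, w = τ j y) :
    IsOpen G := by
  rw [isOpen_iff_mem_nhds]
  intro z' hz'
  obtain ⟨hz'0, δ, hδ, k, τ, hτd, hτne, hτZ⟩ := (hG z').1 hz'
  have h0 : ∀ᶠ y in 𝓝 z', y ≠ 0 := isOpen_ne.mem_nhds hz'0
  filter_upwards [h0, ball_mem_nhds z' hδ] with y hy0 hy
  obtain ⟨hpos, h1, h2, h3⟩ := sheets_mono hy hτd hτne hτZ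
  exact (hG y).2 ⟨hy0, _, hpos, k, τ, h1, h2, h3⟩

/-- **`G` is stable under non-zero scalars** (the sheets over `c • z'` are `y ↦ c • τ j (c⁻¹ • y)`).
[folklore] -/
theorem smul_mem_of_good (hcone : ∀ (c : ℂ) (x : (Fin d → ℂ) × (Fin (m + 1) → ℂ)), x ∈ Z → c • x ∈ Z)
    (hG : ∀ z', z' ∈ G ↔ z' ≠ 0 ∧ ∃ δ > 0, ∃ (k : ℕ) (τ : Fin k → (Fin d → ℂ) → (Fin (m + 1) → ℂ)),
      (∀ j, DifferentiableOn ℂ (τ j) (ball z' δ)) ∧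
      (∀ y ∈ ball z' δ, ∀ j j', j ≠ j' → τ j y ≠ τ j' y) ∧
      ∀ y ∈ ball z' δ, ∀ w, (y, w) ∈ Z ↔ ∃ j, w = τ j y)
    {c : ℂ} (hc : c ≠ 0) {z' : Fin d → ℂ} (hz' : z' ∈ G) : c • z' ∈ G := by
  obtain ⟨hz'0, δ, hδ, k, τ, hτd, hτne, hτZ⟩ := (hG z').1 hz'
  have hcn : 0 < ‖c‖ := norm_pos_iff.2 hc
  -- membership in `Z` is scaling invariant
  have hZiff : ∀ x : (Fin d → ℂ) × (Fin (m + 1) → ℂ), x ∈ Z ↔ c⁻¹ • x ∈ Z := fun x =>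
    ⟨fun hx => hcone _ _ hx, fun hx => by
      have := hcone c _ hx; rwa [smul_smul, mul_inv_cancel₀ hc, one_smul] at this⟩
  -- the preimage ball
  have hball : ∀ y ∈ ball (c • z') (‖c‖ * δ), c⁻¹ • y ∈ ball z' δ := by
    intro y hy
    rw [mem_ball, dist_eq_norm] at hy ⊢
    have : c⁻¹ • y - z' = c⁻¹ • (y - c • z') := by
      rw [smul_sub, smul_smul, inv_mul_cancel₀ hc, one_smul]
    rw [this, norm_smul, norm_inv, inv_mul_lt_iff₀ hcn]
    exact hy
  refine (hG _).2 ⟨smul_ne_zero hc hz'0, ‖c‖ * δ, mul_pos hcn hδ, k,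
    fun j y => c • τ j (c⁻¹ • y), fun j => ?_, fun y hy j j' hjj' heq => ?_, fun y hy w => ?_⟩
  · have hlin : DifferentiableOn ℂ (fun y : Fin d → ℂ => c⁻¹ • y) (ball (c • z') (‖c‖ * δ)) :=
      fun y _ => (differentiableAt_id.const_smul c⁻¹).differentiableWithinAt
    exact ((hτd j).comp hlin hball).const_smul c
  · apply hτne (c⁻¹ • y) (hball y hy) j j' hjj'
    have := congrArg (fun v => c⁻¹ • v) heq
    simpa only [smul_smul, inv_mul_cancel₀ hc, one_smul] using this
  · rw [hZiff, Prod.smul_mk, hτZ (c⁻¹ • y) (hball y hy)]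
    constructor
    · rintro ⟨j, hj⟩
      refine ⟨j, ?_⟩
      have := congrArg (fun v => c • v) hj
      simpa only [smul_smul, mul_inv_cancel₀ hc, one_smul] using this
    · rintro ⟨j, rfl⟩
      exact ⟨j, by rw [smul_smul, inv_mul_cancel₀ hc, one_smul]⟩

/-- **Good points near every base point off the vertex, and thinness of the complement of `G`
off the vertex**: every `z'₀ ≠ 0` has a ball carrying a holomorphic `Δ`, not identically zero near
`z'₀`, whose non-vanishing at a point `y ≠ 0` of the ball forces `y ∈ G` (the discriminant of the
local analytic cover `exists_local_cover`). [cite: Chirka1989, §4.1, p. 42] -/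
theorem exists_thin_of_good (hcl : IsClosed Z)
    (han : ∀ x : (Fin d → ℂ) × (Fin (m + 1) → ℂ), x ≠ 0 → IsZeroSetAt Z x)
    {C : ℝ} (hC : ∀ x ∈ Z, ‖x.2‖ ≤ C * ‖x.1‖)
    (hG : ∀ z', z' ∈ G ↔ z' ≠ 0 ∧ ∃ δ > 0, ∃ (k : ℕ) (τ : Fin k → (Fin d → ℂ) → (Fin (m + 1) → ℂ)),
      (∀ j, DifferentiableOn ℂ (τ j) (ball z' δ)) ∧
      (∀ y ∈ ball z' δ, ∀ j j', j ≠ j' → τ j y ≠ τ j' y) ∧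
      ∀ y ∈ ball z' δ, ∀ w, (y, w) ∈ Z ↔ ∃ j, w = τ j y)
    {z'₀ : Fin d → ℂ} (hz'₀ : z'₀ ≠ 0) :
    ∃ ε > 0, ∃ Δ : (Fin d → ℂ) → ℂ, DifferentiableOn ℂ Δ (ball z'₀ ε) ∧
      (∀ y ∈ ball z'₀ ε, ¬ Δ =ᶠ[𝓝 y] 0) ∧ ∀ y ∈ ball z'₀ ε, y ≠ 0 → Δ y ≠ 0 → y ∈ G := by
  obtain ⟨ε, hε, Δ, K, hΔd, hΔne, -, hgood⟩ := exists_local_cover hcl han hC hz'₀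
  exact ⟨ε, hε, Δ, hΔd, hΔne, fun y hy hy0 hΔy => (hG y).2 ⟨hy0, hgood y hy hΔy⟩⟩

/-- **Every base point off the vertex lies in the closure of `G`** (`Δ ≢ 0` near it).
[folklore] -/
theorem mem_closure_of_good (hcl : IsClosed Z)
    (han : ∀ x : (Fin d → ℂ) × (Fin (m + 1) → ℂ), x ≠ 0 → IsZeroSetAt Z x)
    {C : ℝ} (hC : ∀ x ∈ Z, ‖x.2‖ ≤ C * ‖x.1‖)
    (hG : ∀ z', z' ∈ G ↔ z' ≠ 0 ∧ ∃ δ > 0, ∃ (k : ℕ) (τ : Fin k → (Fin d → ℂ) → (Fin (m + 1) → ℂ)),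
      (∀ j, DifferentiableOn ℂ (τ j) (ball z' δ)) ∧
      (∀ y ∈ ball z' δ, ∀ j j', j ≠ j' → τ j y ≠ τ j' y) ∧
      ∀ y ∈ ball z' δ, ∀ w, (y, w) ∈ Z ↔ ∃ j, w = τ j y)
    {z'₀ : Fin d → ℂ} (hz'₀ : z'₀ ≠ 0) : z'₀ ∈ closure G := by
  obtain ⟨ε, hε, Δ, -, hΔne, hgood⟩ := exists_thin_of_good hcl han hC hG hz'₀
  rw [mem_closure_iff_frequently]
  have hfr : ∃ᶠ y in 𝓝 z'₀, Δ y ≠ 0 := by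
    have := hΔne z'₀ (mem_ball_self hε)
    simpa [Filter.EventuallyEq, Filter.not_eventually] using this
  have hev : ∀ᶠ y in 𝓝 z'₀, y ∈ ball z'₀ ε ∧ y ≠ 0 := by
    filter_upwards [ball_mem_nhds z'₀ hε, isOpen_ne.mem_nhds hz'₀] with y h1 h2
    exact ⟨h1, h2⟩
  exact (hfr.and_eventually hev).mono fun y hy => hgood y hy.2.1 hy.2.2 hy.1

/-- **The vertex lies in the closure of `G`** as soon as `ℂᵈ ≠ 0` (scale a point of `G` towards
`0`). [folklore] -/
theorem zero_mem_closure_of_good (hcl : IsClosed Z)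
    (hcone : ∀ (c : ℂ) (x : (Fin d → ℂ) × (Fin (m + 1) → ℂ)), x ∈ Z → c • x ∈ Z)
    (han : ∀ x : (Fin d → ℂ) × (Fin (m + 1) → ℂ), x ≠ 0 → IsZeroSetAt Z x)
    {C : ℝ} (hC : ∀ x ∈ Z, ‖x.2‖ ≤ C * ‖x.1‖)
    (hG : ∀ z', z' ∈ G ↔ z' ≠ 0 ∧ ∃ δ > 0, ∃ (k : ℕ) (τ : Fin k → (Fin d → ℂ) → (Fin (m + 1) → ℂ)),
      (∀ j, DifferentiableOn ℂ (τ j) (ball z' δ)) ∧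
      (∀ y ∈ ball z' δ, ∀ j j', j ≠ j' → τ j y ≠ τ j' y) ∧
      ∀ y ∈ ball z' δ, ∀ w, (y, w) ∈ Z ↔ ∃ j, w = τ j y)
    (i₀ : Fin d) : (0 : Fin d → ℂ) ∈ closure G := by
  -- a point of `G`
  have hne : ∃ z₁ : Fin d → ℂ, z₁ ∈ G := by
    have h1 : (Pi.single i₀ (1 : ℂ) : Fin d → ℂ) ≠ 0 := by
      intro h; have := congrFun h i₀; simp at this
    have := mem_closure_of_good hcl han hC hG h1
    obtain ⟨z₁, -, hz₁⟩ := mem_closure_iff_nhds.1 this univ Filter.univ_mem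
    exact ⟨z₁, hz₁⟩
  obtain ⟨z₁, hz₁⟩ := hne
  rw [mem_closure_iff_seq_limit]
  refine ⟨fun k : ℕ => (1 / ((k : ℂ) + 1)) • z₁, fun k => ?_, ?_⟩
  · exact smul_mem_of_good hcone hG (one_div_ne_zero (Nat.cast_add_one_ne_zero k)) hz₁
  · simpa only [zero_smul] using
      (tendsto_one_div_add_atTop_nhds_zero_nat (𝕜 := ℂ)).smul_const z₁

/-- **Scaling of the fibres**: the fibre over `c • z'` is `c •` the fibre over `z'`. [folklore] -/
theorem fibre_smul (hcone : ∀ (c : ℂ) (x : (Fin d → ℂ) × (Fin (m + 1) → ℂ)), x ∈ Z → c • x ∈ Z)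
    {c : ℂ} (hc : c ≠ 0) (z' : Fin d → ℂ) :
    {w : Fin (m + 1) → ℂ | (c • z', w) ∈ Z} = (fun w => c • w) '' {w | (z', w) ∈ Z} := by
  ext w
  simp only [mem_setOf_eq, mem_image]
  constructor
  · intro hw
    refine ⟨c⁻¹ • w, ?_, by rw [smul_smul, mul_inv_cancel₀ hc, one_smul]⟩
    have := hcone c⁻¹ _ hw
    rwa [Prod.smul_mk, smul_smul, inv_mul_cancel₀ hc, one_smul] at this
  · rintro ⟨v, hv, rfl⟩
    exact hcone c _ hv

/-- **Uniform bound for the fibres off the vertex**: there is `K` such that every fibre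
`{w | (z', w) ∈ Z}`, `z' ≠ 0`, has at most `K` points (local bounds from `exists_local_cover`,
compactness of the unit sphere of `ℂᵈ`, and scaling invariance of the fibre cardinality).
[cite: Chirka1989, §3.7 Thm., §4.1] -/
theorem exists_forall_fibre_card_le (hcl : IsClosed Z)
    (hcone : ∀ (c : ℂ) (x : (Fin d → ℂ) × (Fin (m + 1) → ℂ)), x ∈ Z → c • x ∈ Z)
    (han : ∀ x : (Fin d → ℂ) × (Fin (m + 1) → ℂ), x ≠ 0 → IsZeroSetAt Z x)
    {C : ℝ} (hC : ∀ x ∈ Z, ‖x.2‖ ≤ C * ‖x.1‖) :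
    ∃ K : ℕ, ∀ z' : Fin d → ℂ, z' ≠ 0 →
      ∃ T : Finset (Fin (m + 1) → ℂ), T.card ≤ K ∧ {w | (z', w) ∈ Z} ⊆ ↑T := by
  classical
  -- local bounds on balls around the points of the unit sphere
  have hloc : ∀ z' : sphere (0 : Fin d → ℂ) 1, ∃ ε > 0, ∃ K : ℕ, ∀ y ∈ ball (z' : Fin d → ℂ) ε,
      ∃ T : Finset (Fin (m + 1) → ℂ), T.card ≤ K ∧ {w | (y, w) ∈ Z} ⊆ ↑T := by
    intro z'
    have hz'0 : (z' : Fin d → ℂ) ≠ 0 := by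
      intro h; have := z'.2; rw [mem_sphere_zero_iff_norm, h, norm_zero] at this; exact zero_ne_one this
    obtain ⟨ε, hε, Δ, K, -, -, hK, -⟩ := exists_local_cover hcl han hC hz'0
    exact ⟨ε, hε, K, hK⟩
  choose ε hε K hK using hloc
  obtain ⟨t, ht⟩ := (isCompact_sphere (0 : Fin d → ℂ) 1).elim_finite_subcover
    (fun z' : sphere (0 : Fin d → ℂ) 1 => ball (z' : Fin d → ℂ) (ε z')) (fun z' => isOpen_ball)
    (fun z' hz' => mem_iUnion.2 ⟨⟨z', hz'⟩, mem_ball_self (hε _)⟩)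
  refine ⟨t.sup K, fun z' hz' => ?_⟩
  -- normalise `z'` to the unit sphere
  have hn : 0 < ‖z'‖ := norm_pos_iff.2 hz'
  set u : Fin d → ℂ := ((‖z'‖⁻¹ : ℝ) : ℂ) • z' with hu
  have hu1 : u ∈ sphere (0 : Fin d → ℂ) 1 := by
    rw [mem_sphere_zero_iff_norm, hu, norm_smul, Complex.norm_real, Real.norm_of_nonneg
      (inv_nonneg.2 hn.le), inv_mul_cancel₀ hn.ne']
  obtain ⟨a, hat, hau⟩ : ∃ a ∈ t, u ∈ ball (a : Fin d → ℂ) (ε a) := by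
    simpa only [mem_iUnion, exists_prop] using ht hu1
  obtain ⟨T, hTcard, hTsub⟩ := hK a u hau
  set c : ℂ := ((‖z'‖ : ℝ) : ℂ) with hc_def
  have hc : c ≠ 0 := by rw [hc_def]; exact_mod_cast hn.ne'
  have hz'u : z' = c • u := by
    rw [hu, hc_def, smul_smul, ← Complex.ofReal_mul, mul_inv_cancel₀ hn.ne', Complex.ofReal_one,
      one_smul]
  refine ⟨T.image fun w => c • w, ?_, ?_⟩
  · exact Finset.card_image_le.trans (hTcard.trans (Finset.le_sup hat))
  · rw [hz'u, fibre_smul hcone hc u, Finset.coe_image]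
    exact image_mono hTsub

/-! ### The cover piece over a punctured ball -/

/-- **The part of `Z` over `G ∩ (ball 0 ρ ∖ {0})` is a cover piece** in the sense of
`Literature.Analysis.Complex.SCV.CoverPiece` (base `ball 0 ρ ∖ {0}`, thin complement by
`exists_thin_of_good`, fibre coordinates bounded by `C ρ`, at most `K` sheets).
[cite: Chirka1989, §4.1–4.2, pp. 42–45] -/
theorem coverPiece_of_good (hcl : IsClosed Z)
    (han : ∀ x : (Fin d → ℂ) × (Fin (m + 1) → ℂ), x ≠ 0 → IsZeroSetAt Z x)
    {C : ℝ} (hC0 : 0 < C) (hC : ∀ x ∈ Z, ‖x.2‖ ≤ C * ‖x.1‖)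
    (hG : ∀ z', z' ∈ G ↔ z' ≠ 0 ∧ ∃ δ > 0, ∃ (k : ℕ) (τ : Fin k → (Fin d → ℂ) → (Fin (m + 1) → ℂ)),
      (∀ j, DifferentiableOn ℂ (τ j) (ball z' δ)) ∧
      (∀ y ∈ ball z' δ, ∀ j j', j ≠ j' → τ j y ≠ τ j' y) ∧
      ∀ y ∈ ball z' δ, ∀ w, (y, w) ∈ Z ↔ ∃ j, w = τ j y)
    {K : ℕ} (hK : ∀ z' : Fin d → ℂ, z' ≠ 0 →
      ∃ T : Finset (Fin (m + 1) → ℂ), T.card ≤ K ∧ {w | (z', w) ∈ Z} ⊆ ↑T) (ρ : ℝ) :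
    CoverPiece {x : (Fin d → ℂ) × (Fin (m + 1) → ℂ) | x ∈ Z ∧ x.1 ∈ G ∩ (ball 0 ρ \ {0})}
      (ball 0 ρ \ {0}) (G ∩ (ball 0 ρ \ {0})) K (C * ρ) where
  isOpen_base := isOpen_ball.sdiff isClosed_singleton
  isOpen := (isOpen_of_good hG).inter (isOpen_ball.sdiff isClosed_singleton)
  subset := inter_subset_right
  thin := by
    rintro z ⟨hzV, hzG⟩
    have hz0 : z ≠ 0 := hzV.2
    obtain ⟨ε, hε, Δ, hΔd, hΔne, hgood⟩ := exists_thin_of_good hcl han hC hG hz0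
    refine ⟨Δ, ball z ε ∩ (ball 0 ρ \ {0}), isOpen_ball.inter (isOpen_ball.sdiff isClosed_singleton),
      ⟨mem_ball_self hε, hzV⟩, inter_subset_right, hΔd.mono inter_subset_left, ?_,
      hΔne z (mem_ball_self hε)⟩
    rintro x ⟨⟨hxV, hxG⟩, hxball, -⟩
    by_contra hΔx
    exact hxG ⟨hgood x hxball hxV.2 hΔx, hxV⟩
  fst_mem := fun x hx => hx.2
  norm_le := by
    rintro x ⟨hxZ, -, hxball, -⟩
    rw [mem_ball, dist_zero_right] at hxball
    exact (hC x hxZ).trans (mul_le_mul_of_nonneg_left hxball.le hC0.le)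
  sheets := by
    rintro z₀ ⟨hz₀G, hz₀V⟩
    obtain ⟨hz₀0, δ, hδ, k, τ, hτd, hτne, hτZ⟩ := (hG z₀).1 hz₀G
    -- a ball around `z₀` inside `G ∩ (ball 0 ρ ∖ {0})`
    have hz₀n : 0 < ‖z₀‖ := norm_pos_iff.2 hz₀0
    have hz₀ρ : ‖z₀‖ < ρ := by simpa using hz₀V.1
    set δ₀ := min δ (min (ρ - ‖z₀‖) ‖z₀‖) with hδ₀
    have hδ₀pos : 0 < δ₀ := lt_min hδ (lt_min (by linarith) hz₀n)
    have hδ₀δ : ball z₀ δ₀ ⊆ ball z₀ δ := ball_subset_ball (min_le_left _ _)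
    have hballV : ball z₀ δ₀ ⊆ ball 0 ρ \ {0} := by
      intro y hy
      rw [mem_ball, dist_eq_norm] at hy
      have hy1 : ‖y - z₀‖ < ρ - ‖z₀‖ := hy.trans_le ((min_le_right _ _).trans (min_le_left _ _))
      have hy2 : ‖y - z₀‖ < ‖z₀‖ := hy.trans_le ((min_le_right _ _).trans (min_le_right _ _))
      refine ⟨?_, ?_⟩
      · rw [mem_ball, dist_zero_right]
        calc ‖y‖ ≤ ‖y - z₀‖ + ‖z₀‖ := norm_le_norm_sub_add y z₀
          _ < ρ := by linarith
      · intro hy0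
        rw [mem_singleton_iff] at hy0
        rw [hy0, zero_sub, norm_neg] at hy2
        exact lt_irrefl _ hy2
    have hballG : ball z₀ δ₀ ⊆ G := by
      intro y hy
      obtain ⟨hpos, h1, h2, h3⟩ := sheets_mono (hδ₀δ hy) hτd hτne hτZ
      exact (hG y).2 ⟨(hballV hy).2, _, hpos, k, τ, h1, h2, h3⟩
    -- the number of sheets is the cardinality of the fibre over `z₀`, at most `K`
    have hkK : k ≤ K := by
      obtain ⟨T, hTcard, hTsub⟩ := hK z₀ hz₀0
      have hinj : Function.Injective fun j => τ j z₀ := fun j j' h => by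
        by_contra hjj'; exact hτne z₀ (mem_ball_self hδ) j j' hjj' h
      have hsub : (Finset.univ.image fun j => τ j z₀) ⊆ T := by
        intro w hw
        obtain ⟨j, -, rfl⟩ := Finset.mem_image.1 hw
        exact hTsub ((hτZ z₀ (mem_ball_self hδ) _).2 ⟨j, rfl⟩)
      have := Finset.card_le_card hsub
      rw [Finset.card_image_of_injective _ hinj, Finset.card_univ, Fintype.card_fin] at this
      exact this.trans hTcard
    refine ⟨δ₀, hδ₀pos, fun y hy => ⟨hballG hy, hballV hy⟩, k, τ, hkK,
      fun j => (hτd j).mono hδ₀δ, fun y hy => hτne y (hδ₀δ hy), fun y hy w => ?_⟩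
    rw [← hτZ y (hδ₀δ hy) w]
    exact ⟨fun hx => hx.1, fun hx => ⟨hx, hballG hy, hballV hy⟩⟩

/-! ### Extension of the canonical defining functions across the vertex -/

/-- The vertex is a limit point of the punctured ball (`ℂᵈ ≠ 0`). [folklore] -/
theorem zero_mem_closure_ball_diff (i₀ : Fin d) {ρ : ℝ} (hρ : 0 < ρ) :
    (0 : Fin d → ℂ) ∈ closure (ball (0 : Fin d → ℂ) ρ \ {0}) := by
  rw [Metric.mem_closure_iff]
  intro ε hε
  set s : ℝ := min (ε / 2) (ρ / 2) with hs
  have hs0 : 0 < s := lt_min (by positivity) (by positivity)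
  have hnorm : ‖((s : ℝ) : ℂ) • (Pi.single i₀ (1 : ℂ) : Fin d → ℂ)‖ = s := by
    rw [norm_smul, Complex.norm_real, Real.norm_of_nonneg hs0.le, Pi.norm_single, norm_one, mul_one]
  refine ⟨((s : ℝ) : ℂ) • Pi.single i₀ 1, ⟨?_, ?_⟩, ?_⟩
  · rw [mem_ball, dist_zero_right, hnorm]; exact (min_le_right _ _).trans_lt (by linarith)
  · rw [mem_singleton_iff, ← norm_eq_zero, hnorm]; exact hs0.ne'
  · rw [dist_comm, dist_zero_right, hnorm]; exact (min_le_left _ _).trans_lt (by linarith)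

/-- A coordinate of the base is not identically zero near any point of `ℂᵈ × ℂᵐ⁺¹` (so that the
hyperplane `{z'_{i₀} = 0}` is a thin set). [folklore] -/
theorem not_eventuallyEq_zero_fst_apply (i₀ : Fin d) (a : (Fin d → ℂ) × (Fin (m + 1) → ℂ)) :
    ¬ (fun x : (Fin d → ℂ) × (Fin (m + 1) → ℂ) => x.1 i₀) =ᶠ[𝓝 a] 0 := by
  intro h
  obtain ⟨ε, hε, hball⟩ := Metric.eventually_nhds_iff_ball.1 h
  have ha : a.1 i₀ = 0 := hball a (mem_ball_self hε)
  set v : (Fin d → ℂ) × (Fin (m + 1) → ℂ) := (((ε / 2 : ℝ) : ℂ) • Pi.single i₀ 1, 0) with hv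
  have hvn : ‖v‖ = ε / 2 := by
    rw [hv, Prod.norm_def, norm_smul, Complex.norm_real, Real.norm_of_nonneg (by positivity),
      Pi.norm_single, norm_one, mul_one, norm_zero, max_eq_left (by positivity)]
  have hmem : a + v ∈ ball a ε := by
    rw [mem_ball, dist_eq_norm, add_sub_cancel_left, hvn]; linarith
  have := hball (a + v) hmem
  simp only [Prod.fst_add, Pi.add_apply, ha, zero_add, Pi.zero_apply, hv, Pi.smul_apply,
    Pi.single_eq_same, smul_eq_mul, mul_one, Complex.ofReal_eq_zero] at this
  linarith

/-- Bounds pass to limit points: if `f` is continuous at `x ∈ closure s` and `‖f‖ ≤ b` on `s`, then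
`‖f x‖ ≤ b`. [folklore] -/
theorem norm_le_of_mem_closure {X Y : Type*} [TopologicalSpace X] [NormedAddCommGroup Y]
    {f : X → Y} {s : Set X} {x : X} (hf : ContinuousAt f x) (hx : x ∈ closure s) {b : ℝ}
    (hb : ∀ y ∈ s, ‖f y‖ ≤ b) : ‖f x‖ ≤ b := by
  haveI : (𝓝[s] x).NeBot := mem_closure_iff_nhdsWithin_neBot.1 hx
  have hlim : Tendsto (fun y => ‖f y‖) (𝓝[s] x) (𝓝 ‖f x‖) :=
    (hf.tendsto.mono_left nhdsWithin_le_nhds).norm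
  exact le_of_tendsto hlim (eventually_nhdsWithin_of_forall hb)

/-- **The closure of the part of `Z` over `G` is cut out by holomorphic equations near every point
of `ℂᵈ × ℂᵐ⁺¹`, the vertex included** (Chirka §4.3 Thm. over the punctured ball, plus the Riemann
extension theorem across `{0} × ℂᵐ⁺¹`, plus conic invariance). This is the analytic input of the
Remmert–Stein step at the vertex. [cite: Chirka1989, §4.3 Thm. p. 47 and §4.4 Cor. p. 48] -/
theorem isZeroSetAt_closure_good (hcl : IsClosed Z)
    (hcone : ∀ (c : ℂ) (x : (Fin d → ℂ) × (Fin (m + 1) → ℂ)), x ∈ Z → c • x ∈ Z)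
    (han : ∀ x : (Fin d → ℂ) × (Fin (m + 1) → ℂ), x ≠ 0 → IsZeroSetAt Z x)
    (hiso : ∀ w, ((0 : Fin d → ℂ), w) ∈ Z → w = 0)
    (hG : ∀ z', z' ∈ G ↔ z' ≠ 0 ∧ ∃ δ > 0, ∃ (k : ℕ) (τ : Fin k → (Fin d → ℂ) → (Fin (m + 1) → ℂ)),
      (∀ j, DifferentiableOn ℂ (τ j) (ball z' δ)) ∧
      (∀ y ∈ ball z' δ, ∀ j j', j ≠ j' → τ j y ≠ τ j' y) ∧
      ∀ y ∈ ball z' δ, ∀ w, (y, w) ∈ Z ↔ ∃ j, w = τ j y)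
    (i₀ : Fin d) (x : (Fin d → ℂ) × (Fin (m + 1) → ℂ)) :
    IsZeroSetAt (closure {x : (Fin d → ℂ) × (Fin (m + 1) → ℂ) | x ∈ Z ∧ x.1 ∈ G}) x := by
  classical
  obtain ⟨C, hC0, hC⟩ := exists_norm_snd_le_mul_norm_fst hcl hcone hiso
  obtain ⟨K, hK⟩ := exists_forall_fibre_card_le hcl hcone han hC
  -- notation
  set T : Set ((Fin d → ℂ) × (Fin (m + 1) → ℂ)) := {x | x ∈ Z ∧ x.1 ∈ G} with hT
  set V' : Set (Fin d → ℂ) := ball 0 1 \ {0} with hV'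
  set G' : Set (Fin d → ℂ) := G ∩ V' with hG'
  set S : Set ((Fin d → ℂ) × (Fin (m + 1) → ℂ)) := {x | x ∈ Z ∧ x.1 ∈ G'} with hS
  set U : Set ((Fin d → ℂ) × (Fin (m + 1) → ℂ)) := ball (0 : Fin d → ℂ) 1 ×ˢ univ with hU
  set A : Set ((Fin d → ℂ) × (Fin (m + 1) → ℂ)) := {x | x.1 = 0} with hA
  have h : CoverPiece S V' G' K (C * 1) := coverPiece_of_good hcl han hC0 hC hG hK 1
  have hUo : IsOpen U := isOpen_ball.prod isOpen_univ
  have hUA : U \ A = V' ×ˢ univ := by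
    ext y
    simp only [hU, hA, hV', Set.mem_sdiff, mem_prod, mem_univ, and_true, mem_setOf_eq,
      mem_singleton_iff]
  have hV'o : IsOpen (V' ×ˢ (univ : Set (Fin (m + 1) → ℂ))) := h.isOpen_base.prod isOpen_univ
  -- all base points of `U` are in the closure of `G'`
  have hUG : ∀ y ∈ U, y.1 ∈ closure G' := by
    intro y hy
    by_cases hy0 : y.1 = 0
    · rw [hy0]
      have h1 : (0 : Fin d → ℂ) ∈ closure V' := zero_mem_closure_ball_diff i₀ one_pos
      exact closure_closure (s := G') ▸ closure_mono h.subset_closure h1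
    · exact h.subset_closure ⟨hy.1, hy0⟩
  -- the extended canonical defining functions on the punctured ball, and their bound
  choose Φ hΦd hΦeq using fun t => h.exists_extension_defFn t
  set B : ℂ → ℝ → ℝ := fun t r =>
    (max 1 ((∑ i : Fin (m + 1), ‖t‖ ^ (i : ℕ)) * (r + max (C * 1) 0))) ^ K with hB
  have hBmono : ∀ t, Monotone (B t) := fun t r r' hrr' =>
    pow_le_pow_left₀ (le_trans zero_le_one (le_max_left _ _)) (max_le_max le_rfl
      (mul_le_mul_of_nonneg_left (add_le_add hrr' le_rfl)
        (Finset.sum_nonneg fun i _ => by positivity))) K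
  have hbd : ∀ t, ∀ y ∈ V' ×ˢ (univ : Set (Fin (m + 1) → ℂ)), ‖Φ t y‖ ≤ B t (‖y.2‖ + 1) := by
    rintro t ⟨z', w⟩ ⟨hz', -⟩
    have hcl' : ((z', w) : (Fin d → ℂ) × (Fin (m + 1) → ℂ)) ∈ closure (G' ×ˢ ball w 1) := by
      rw [closure_prod_eq]
      exact ⟨h.subset_closure hz', subset_closure (mem_ball_self one_pos)⟩
    refine norm_le_of_mem_closure ((hΦd t).continuousOn.continuousAt (hV'o.mem_nhds
      ⟨hz', mem_univ _⟩)) hcl' fun y hy => ?_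
    rw [hΦeq t ⟨hy.1, mem_univ _⟩]
    refine (h.norm_defFn_le t y).trans (hBmono t ?_)
    have : dist y.2 w < 1 := hy.2
    rw [dist_eq_norm] at this
    linarith [norm_le_norm_sub_add y.2 w]
  -- Riemann extension across `{0} × ℂᵐ⁺¹`
  have hext : ∀ t, ∃ Ψ : (Fin d → ℂ) × (Fin (m + 1) → ℂ) → ℂ, DifferentiableOn ℂ Ψ U ∧
      EqOn Ψ (Φ t) (U \ A) := by
    intro t
    refine exists_differentiableOn_eqOn_of_thin (by rw [hUA]; exact hV'o) ?_
      (by rw [hUA]; exact hΦd t) ?_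
    · -- thinness of `A`
      rintro a ⟨-, haU⟩
      refine ⟨fun y => y.1 i₀, U, hUo, haU, Subset.rfl, ?_, fun y hy => ?_,
        not_eventuallyEq_zero_fst_apply i₀ a⟩
      · exact (((ContinuousLinearMap.proj i₀).comp (ContinuousLinearMap.fst ℂ (Fin d → ℂ)
          (Fin (m + 1) → ℂ))).differentiable).differentiableOn
      · have : y.1 = 0 := hy.1
        simp [this]
    · -- local boundedness near `A`
      rintro a ⟨-, haU⟩
      refine ⟨U ∩ {y | ‖y.2‖ < ‖a.2‖ + 1}, Filter.inter_mem (hUo.mem_nhds haU)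
        ((isOpen_lt (continuous_snd.norm) continuous_const).mem_nhds (by simp)),
        B t (‖a.2‖ + 2), fun y hy => ?_⟩
      have hyUA : y ∈ U \ A := ⟨hy.1.1, hy.2⟩
      rw [hUA] at hyUA
      refine (hbd t y hyUA).trans (hBmono t ?_)
      have : ‖y.2‖ < ‖a.2‖ + 1 := hy.1.2
      linarith
  choose Ψ hΨd hΨeq using hext
  -- the extensions still agree with the canonical defining functions over `G'`
  have hΨeq' : ∀ t, EqOn (Ψ t) (h.defFn t) (G' ×ˢ univ) := by
    intro t y hy
    have hyUA : y ∈ U \ A := by rw [hUA]; exact ⟨hy.1.2, mem_univ _⟩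
    rw [hΨeq t hyUA, hΦeq t hy]
  -- the closure identity on `U`
  have hclos := h.closure_inter_eq_of_eqOn_defFn hUo hUG Ψ (fun t => (hΨd t).continuousOn) hΨeq'
  -- `S = T ∩ U`, so `closure T ∩ U = closure S ∩ U`
  have hST : S = T ∩ U := by
    ext y
    simp only [hS, hT, hU, hG', hV', mem_setOf_eq, mem_inter_iff, mem_prod, mem_univ, and_true,
      Set.mem_sdiff, mem_singleton_iff]
    constructor
    · rintro ⟨hyZ, hyG, hyb, -⟩; exact ⟨⟨hyZ, hyG⟩, hyb⟩
    · rintro ⟨⟨hyZ, hyG⟩, hyb⟩; exact ⟨hyZ, hyG, hyb, ((hG _).1 hyG).1⟩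
  have hTU : closure T ∩ U = closure S ∩ U := by
    apply Subset.antisymm
    · rw [hST]
      intro y hy
      exact ⟨(hUo.inter_closure ⟨hy.2, hy.1⟩ |> closure_mono (by rw [inter_comm])), hy.2⟩
    · rw [hST]
      exact inter_subset_inter_left _ (closure_mono inter_subset_left)
  -- zero set description near points of `U`
  set M := K * (m + 1 - 1) + 1 with hM
  have hzero : ∀ y ∈ U, IsZeroSetAt (closure T) y := by
    intro y hy
    refine ⟨U, hUo, hy, M, fun y i => Ψ ((i : ℕ) : ℂ) y, differentiableOn_pi.2 fun i => hΨd _, ?_⟩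
    rw [hTU, hclos]
    ext y'
    simp only [mem_inter_iff, mem_setOf_eq, mem_preimage, mem_singleton_iff, funext_iff,
      Pi.zero_apply]
  -- move an arbitrary point into `U` by a scaling
  set c : ℝ := 1 / (‖x.1‖ + 1) with hc
  have hc0 : 0 < c := by positivity
  have hcc : ((c : ℝ) : ℂ) ≠ 0 := by exact_mod_cast hc0.ne'
  have hcx : ((c : ℝ) : ℂ) • x ∈ U := by
    refine ⟨?_, mem_univ _⟩
    rw [Prod.smul_fst, mem_ball, dist_zero_right, norm_smul, Complex.norm_real,
      Real.norm_of_nonneg hc0.le, hc, one_div, inv_mul_lt_iff₀ (by positivity)]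
    linarith
  -- `T`, hence `closure T`, is invariant under non-zero scalings
  have hTsmul : ∀ (a : ℂ), a ≠ 0 → ∀ y ∈ T, a • y ∈ T := fun a ha y hy =>
    ⟨hcone a y hy.1, by rw [Prod.smul_fst]; exact smul_mem_of_good hcone hG ha hy.2⟩
  set Θ : ((Fin d → ℂ) × (Fin (m + 1) → ℂ)) ≃L[ℂ] ((Fin d → ℂ) × (Fin (m + 1) → ℂ)) :=
    (LinearEquiv.smulOfNeZero ℂ _ ((c : ℝ) : ℂ) hcc).toContinuousLinearEquiv with hΘ
  have hΘapply : ∀ y, Θ y = ((c : ℝ) : ℂ) • y := fun y => by simp [hΘ]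
  have hΘsymm : ∀ y, Θ.symm y = ((c : ℝ) : ℂ)⁻¹ • y := fun y => by
    apply Θ.injective
    rw [ContinuousLinearEquiv.apply_symm_apply, hΘapply, smul_smul, mul_inv_cancel₀ hcc, one_smul]
  have himT : Θ.symm '' T = T := by
    apply Subset.antisymm
    · rintro _ ⟨y, hy, rfl⟩
      rw [hΘsymm]; exact hTsmul _ (inv_ne_zero hcc) y hy
    · intro y hy
      refine ⟨Θ y, ?_, Θ.symm_apply_apply y⟩
      rw [hΘapply]; exact hTsmul _ hcc y hy
  have himage : Θ.symm '' closure T = closure T := by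
    have h1 : Θ.symm '' closure T = closure (Θ.symm '' T) := Θ.symm.toHomeomorph.image_closure T
    rw [h1, himT]
  have := (hzero _ hcx).image_equiv Θ.symm
  rwa [himage, show Θ.symm (((c : ℝ) : ℂ) • x) = x by
    rw [hΘsymm, smul_smul, inv_mul_cancel₀ hcc, one_smul]] at this

/-- The closure of the part of `Z` over `G` is contained in `Z`. [folklore] -/
theorem closure_good_subset (hcl : IsClosed Z) :
    closure {x : (Fin d → ℂ) × (Fin (m + 1) → ℂ) | x ∈ Z ∧ x.1 ∈ G} ⊆ Z :=
  hcl.closure_subset_iff.2 fun _ hx => hx.1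

/-- The closure of the part of `Z` over `G` is stable under all scalars. [folklore] -/
theorem smul_mem_closure_good
    (hcone : ∀ (c : ℂ) (x : (Fin d → ℂ) × (Fin (m + 1) → ℂ)), x ∈ Z → c • x ∈ Z)
    (hG : ∀ z', z' ∈ G ↔ z' ≠ 0 ∧ ∃ δ > 0, ∃ (k : ℕ) (τ : Fin k → (Fin d → ℂ) → (Fin (m + 1) → ℂ)),
      (∀ j, DifferentiableOn ℂ (τ j) (ball z' δ)) ∧
      (∀ y ∈ ball z' δ, ∀ j j', j ≠ j' → τ j y ≠ τ j' y) ∧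
      ∀ y ∈ ball z' δ, ∀ w, (y, w) ∈ Z ↔ ∃ j, w = τ j y)
    (c : ℂ) {x : (Fin d → ℂ) × (Fin (m + 1) → ℂ)}
    (hx : x ∈ closure {x : (Fin d → ℂ) × (Fin (m + 1) → ℂ) | x ∈ Z ∧ x.1 ∈ G}) :
    c • x ∈ closure {x : (Fin d → ℂ) × (Fin (m + 1) → ℂ) | x ∈ Z ∧ x.1 ∈ G} := by
  set T : Set ((Fin d → ℂ) × (Fin (m + 1) → ℂ)) := {x | x ∈ Z ∧ x.1 ∈ G} with hT
  have hTsmul : ∀ (a : ℂ), a ≠ 0 → ∀ y ∈ T, a • y ∈ T := fun a ha y hy =>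
    ⟨hcone a y hy.1, by rw [Prod.smul_fst]; exact smul_mem_of_good hcone hG ha hy.2⟩
  -- non-zero scalars act by homeomorphisms preserving `T`
  have hne : ∀ (a : ℂ), a ≠ 0 → ∀ y ∈ closure T, a • y ∈ closure T := by
    intro a ha y hy
    have hcont : Continuous fun y : (Fin d → ℂ) × (Fin (m + 1) → ℂ) => a • y := continuous_const_smul a
    exact map_mem_closure hcont hy fun y hy => hTsmul a ha y hy
  by_cases hc : c = 0
  · -- `0 • x = 0` is the limit of `a • x`, `a → 0`, `a ≠ 0`
    subst hc
    rw [zero_smul]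
    have hlim : Tendsto (fun k : ℕ => (1 / ((k : ℂ) + 1)) • x) atTop (𝓝 0) := by
      simpa only [zero_smul] using
        (tendsto_one_div_add_atTop_nhds_zero_nat (𝕜 := ℂ)).smul_const x
    have : (0 : (Fin d → ℂ) × (Fin (m + 1) → ℂ)) ∈ closure (closure T) :=
      mem_closure_of_tendsto hlim (Eventually.of_forall fun k =>
        hne _ (one_div_ne_zero (Nat.cast_add_one_ne_zero k)) x hx)
    rwa [closure_closure] at this
  · exact hne c hc x hx

end Good

end Literature.AlgebraicGeometry.Motives

end
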